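import Mathlib
import Literature.Analysis.FluidPDE.TypeIAncientMild
import Literature.Analysis.FluidPDE.BarkerPrange2020VorticityAlignmentTypeIHolds
import Literature.Analysis.FluidPDE.NSLocalLerayBackwardUniqueness
import Literature.Analysis.FluidPDE.HarmonicAnalyticContinuation
import Literature.Analysis.FluidPDE.HarmonicLiouvilleLp
import Literature.Analysis.FluidPDE.TsaiSelfSimilarBounded
import Literature.Analysis.FluidPDE.LocalBiotSavartCalculus
import Summits.NavierStokesRegularity.NavierStokesRegularity.Theorems.ClockStretchingLawClockCeilingOpenSetVorticityLiouville
import Summits.NavierStokesRegularity.NavierStokesRegularity.Theorems.SqueezeCycleExtremalElementExistsRegularity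
import HarnessLib
import Summits.NavierStokesRegularity.NavierStokesRegularity.Theorems.ScenarioCensusJetMeter

/-!
# Census block A2 (amplitude / pointwise meters), cells A2fh / A2fw / A2fj / A2fs (DECIDED), A2fq ⇔ A2fQ (OPEN) — instrument «FORCE METER», LINE «force-meter» port
# (one file): §A flat jets of analytic maps (the two lemmas shared VERBATIM with the jet-meter port taken BY NAME), §B harmonic tools on `ℝ³`, §C the class: slices of `A_C` —
# the endgames `harmonicSliceLiouville` / `forceFreeWindowLiouville` / `forceJetLiouville` / `harmonicVorticity{Slice,Window}Liouville`, §D the pressure source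
# `Q = tr((∇u)²)`, §E the census rows, §F verdicts and nestings; census KEYS `Row_A2fh` / `Row_A2fw` / `Row_A2fj` / `Row_A2fs` + `_excluded`, `Row_A2fq` / `Row_A2fQ` (OPEN)

Re-homed for the scenario census (typer seat ns-census-typer-1 g9; the cells A2fh / A2fw / A2fj / A2fs are MEMBERS OF RECORD «DECIDED IN KERNEL IN FILES» of
block A2 since census v1.93 (critic idea-crit-3 g8 PASS 06:57:06Z — no price; ref ns-census-ref g12 PRE-CHECK ✓ §17.2 item 59; lead-presearch label item 59);
this port makes them TREE-decided): VERBATIM PORT of ns-idea-2 LINE g15-5 «force-meter», `pub/ideators/ns-idea-2/lines/force-meter/line-force-meter.lean` sha16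
303976241115805e (357 l., lean check rc 0, 0 sorry), one tree file (§A–§F + census KEYS).  Lean text VERBATIM in namespace `…Theorems.ScenarioCensus.ForceMeter` (the line's `…Lines.ForceMeter` re-homed); port edits: `local notation "E3"` →
`abbrev E3` (typer lint: no notation in port files), `@[conjecture]` on the OPEN rows `Row_A2fq` / `Row_A2fQ` (typed only), five one-line docstrings added (gate
lint).  Statements untouched.

No census VALUE is moved here (the cells become TREE-decided by name; booking is the lead's); NS regularity is NOT proved; (L′) ⟨10661⟩ is untouched; no
summit statement is proved by this file. Lemmas that restate already-landed tree declarations are taken BY NAME (gate lint `dedup.landed`): `eventually_eq_of_flat_from_one` = `JetMeter.eventually_eq_of_flat_from_one`, `eventually_eq_zero_of_flat` = `JetMeter.eventually_eq_zero_of_flat`.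
-/

-- the summit and its single problem share the name `NavierStokesRegularity` (D-0017 nested layout)
set_option linter.dupNamespace false

open Set Function Filter Topology Metric MeasureTheory InnerProductSpace
open scoped RealInnerProductSpace ENNReal NNReal Nat Laplacian

namespace Summit.NavierStokesRegularity.NavierStokesRegularity.Theorems.ScenarioCensus.ForceMeter

open Literature.Analysis Literature.Analysis.FluidPDE Literature.Analysis.UnboundedOperators
open Summit.NavierStokesRegularity.NavierStokesRegularity.Theorems

/-- `ℝ³` (the line's `local notation "E3"`, spelled as a reducible abbreviation for the tree). -/
abbrev E3 := EuclideanSpace ℝ (Fin 3)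

/-! ## A. Flat jets of analytic maps (generic; verbatim from LINE g15-4 «jet-meter» § A) -/

section Flat

variable {E F : Type*} [NormedAddCommGroup E] [NormedSpace ℝ E] [NormedAddCommGroup F]
  [NormedSpace ℝ F]

/-- A function vanishing near `x₀` has a flat jet at `x₀`. -/
theorem flat_of_eventually_eq_zero {f : E → F} {x₀ : E} (h : ∀ᶠ z in 𝓝 x₀, f z = 0) (n : ℕ) :
    iteratedFDeriv ℝ n f x₀ = 0 := by
  have h' : f =ᶠ[𝓝 x₀] (fun _ => (0 : F)) := h
  rw [(h'.iteratedFDeriv ℝ n).self_of_nhds]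
  simp

/-- **Identity theorem, window form** for a real-analytic map on the whole space: zero on a
nonempty open set ⇒ zero everywhere. -/
theorem eq_zero_of_window {f : E → F} (hf : AnalyticOnNhd ℝ f univ) {U : Set E} (hU : IsOpen U)
    (hne : U.Nonempty) (h0 : ∀ x ∈ U, f x = 0) : ∀ x, f x = 0 := by
  obtain ⟨x₀, hx₀⟩ := hne
  have hev : f =ᶠ[𝓝 x₀] 0 := by
    filter_upwards [hU.mem_nhds hx₀] with z hz
    exact h0 z hz
  have h := hf.eqOn_zero_of_preconnected_of_eventuallyEq_zero
    (convex_univ.isPreconnected) (mem_univ x₀) hev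
  exact fun x => h (mem_univ x)

variable [CompleteSpace F]

-- `eventually_eq_of_flat_from_one`: the line restates the tree's `JetMeter.eventually_eq_of_flat_from_one`; taken BY NAME (gate lint dedup.landed).

-- `eventually_eq_zero_of_flat`: the line restates the tree's `JetMeter.eventually_eq_zero_of_flat`; taken BY NAME (gate lint dedup.landed).

/-- **Identity theorem, jet form**: a flat jet at one point ⇒ zero everywhere. -/
theorem eq_zero_of_flat {f : E → F} (hf : AnalyticOnNhd ℝ f univ) {x₀ : E}
    (hflat : ∀ n : ℕ, iteratedFDeriv ℝ n f x₀ = 0) : ∀ x, f x = 0 := by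
  have hev := JetMeter.eventually_eq_zero_of_flat (hf x₀ (mem_univ _)) hflat
  obtain ⟨U, hUsub, hU, hx₀⟩ := _root_.mem_nhds_iff.1 hev
  exact eq_zero_of_window hf hU ⟨x₀, hx₀⟩ fun x hx => hUsub hx

end Flat

/-! ## B. Harmonic tools on `ℝ³` (tree: `analyticOnNhd_laplacian`, `isConst_of_harmonic_bounded_inner`,
`laplacian_eq_neg_curl_curl`; Mathlib's `InnerProductSpace.laplacian` `Δ` and `HarmonicOnNhd`) -/

/-- A bounded `C²` map `ℝ³ → ℝ³` with `Δf ≡ 0` is constant (Liouville, vector form; tree). -/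
theorem const_of_laplacian_eq_zero_of_bounded {f : E3 → E3} (hf : ContDiff ℝ 2 f)
    (hΔ : ∀ x, Δ f x = 0) (hB : ∃ B, ∀ x, ‖f x‖ ≤ B) (x y : E3) : f x = f y :=
  isConst_of_harmonic_bounded_inner (harmonicOnNhd_of_laplacian_eq_zero hf hΔ) hB x y

/-- The curl of a constant field vanishes. -/
theorem curl_const_eq_zero (c : E3) (x : E3) : curl (fun _ : E3 => c) x = 0 := by
  rw [curl_eq_curlCLM]
  simp

/-- The curl of a `C^∞` field is `C²` (`curl = curlCLM ∘ D`). -/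
theorem contDiff_two_curl {f : E3 → E3} (hf : ContDiff ℝ (⊤ : ℕ∞) f) : ContDiff ℝ 2 (curl f) := by
  rw [curl_eq_curlCLM_comp]
  exact curlCLM.contDiff.comp (hf.fderiv_right (by exact WithTop.coe_le_coe.2 le_top))

/-! ## C. The class: slices of `A_C` -/

variable {C : ℝ} {u : ℝ → E3 → E3}

/-- KNSS gauge bound on the velocity GRADIENT of a slice (class-uniform constant; qualitative use:
boundedness of the vorticity slice). [tree `exists_norm_iteratedFDeriv_le_of_typeI`] -/
theorem slice_fderiv_bound (hu : IsTypeIAncientMild C u) {t : ℝ} (ht : t < 0) :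
    ∃ C₁ : ℝ, ∀ z, ‖fderiv ℝ (u t) z‖ ≤ C₁ := by
  obtain ⟨K₁, hK₁⟩ := exists_norm_iteratedFDeriv_le_of_typeI C 1 (a := t + t) (b := t / 2)
    (δ := -t) (by linarith) (by linarith) (by linarith)
  have htI : t ∈ Ico (t + t + -t) (t / 2) := ⟨by linarith, by linarith⟩
  have hmild : ∀ s t : ℝ, s < t → t < 0 → ∀ x,
      u t x = heatExtension (u s) (t - s) x - oseenDuhamel 1 s u u t x :=
    fun s t hst ht x => hu.mild_eq_heatExtension hst ht x
  refine ⟨K₁, fun z => ?_⟩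
  have h := hK₁ hu.continuousOn_uncurry (fun t ht => hu.isWeaklyDivFree ht) hmild
    hu.hasTypeITimeDecay t htI z
  rwa [← norm_iteratedFDeriv_fderiv, norm_iteratedFDeriv_zero] at h

/-- The vorticity of a slice of a class element is bounded. -/
theorem vorticity_slice_bounded (hu : IsTypeIAncientMild C u) {t : ℝ} (ht : t < 0) :
    ∃ B : ℝ, ∀ z, ‖curl (u t) z‖ ≤ B := by
  obtain ⟨C₁, hC₁⟩ := slice_fderiv_bound hu ht
  exact ⟨‖curlCLM‖ * C₁, fun z =>
    (norm_curl_le _ _).trans (mul_le_mul_of_nonneg_left (hC₁ z) (by positivity))⟩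

/-- **Harmonic-slice Liouville** (the endgame of the line; engine of `Row_A2fh`).  If one slice
`u(t₀,·)`, `t₀ < 0`, has `Δu(t₀,·) ≡ 0` then `u ≡ 0`: the slice is bounded (`‖u(t₀,x)‖ ≤ C/√(−t₀)`)
and harmonic, hence constant (Liouville), and the KNSS gauge kills slice-constant elements
(tree `sliceConstLiouville`). -/
theorem harmonicSliceLiouville (h : IsTypeIAncientMild C u) {t₀ : ℝ} (ht₀ : t₀ < 0)
    (hΔ : ∀ x, Δ (u t₀) x = 0) : ∀ t < 0, ∀ x, u t x = 0 :=
  sliceConstLiouville h ht₀ (b := u t₀ 0) fun x =>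
    const_of_laplacian_eq_zero_of_bounded ((h.contDiff_slice ht₀).of_le (by norm_cast)) hΔ
      ⟨C / Real.sqrt (-t₀), fun z => h.norm_le ht₀ z⟩ x 0

/-- **Force-free pocket** (engine of `Row_A2fw`): `Δu(t₀,·) = 0` on a nonempty open set of one
slice kills the element (slice analyticity, `analyticOnNhd_laplacian`, identity theorem, A2fh). -/
theorem forceFreeWindowLiouville (h : IsTypeIAncientMild C u) {t₀ : ℝ} (ht₀ : t₀ < 0)
    {U : Set E3} (hU : IsOpen U) (hne : U.Nonempty) (h0 : ∀ x ∈ U, Δ (u t₀) x = 0) :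
    ∀ t < 0, ∀ x, u t x = 0 :=
  harmonicSliceLiouville h ht₀
    (eq_zero_of_window (analyticOnNhd_laplacian (h.analyticOnNhd_slice_univ ht₀)) hU hne h0)

/-- **Force jet** (engine of `Row_A2fj`): the viscous force cannot vanish to infinite order at a
single point of a single slice of a nonzero element. -/
theorem forceJetLiouville (h : IsTypeIAncientMild C u) {t₀ : ℝ} (ht₀ : t₀ < 0) {x₀ : E3}
    (hflat : ∀ n : ℕ, iteratedFDeriv ℝ n (Δ (u t₀)) x₀ = 0) : ∀ t < 0, ∀ x, u t x = 0 :=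
  harmonicSliceLiouville h ht₀
    (eq_zero_of_flat (analyticOnNhd_laplacian (h.analyticOnNhd_slice_univ ht₀)) hflat)

/-- **Harmonic-vorticity slice**: `Δω(t₀,·) ≡ 0` kills the element — the bounded harmonic
vorticity slice is CONSTANT (Liouville), so `Δu(t₀) = −curl curl u(t₀) = −curl(const) = 0`
(tree `laplacian_eq_neg_curl_curl`) and `harmonicSliceLiouville` concludes. -/
theorem harmonicVorticitySliceLiouville (h : IsTypeIAncientMild C u) {t₀ : ℝ} (ht₀ : t₀ < 0)
    (hΔω : ∀ x, Δ (curl (u t₀)) x = 0) : ∀ t < 0, ∀ x, u t x = 0 := by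
  have hu2 : ContDiff ℝ 2 (u t₀) := (h.contDiff_slice ht₀).of_le (by norm_cast)
  have hω2 : ContDiff ℝ 2 (curl (u t₀)) := contDiff_two_curl (h.contDiff_slice ht₀)
  have hωc : ∀ x, curl (u t₀) x = curl (u t₀) 0 := fun x =>
    const_of_laplacian_eq_zero_of_bounded hω2 hΔω (vorticity_slice_bounded h ht₀) x 0
  have hfun : curl (u t₀) = fun _ => curl (u t₀) 0 := funext hωc
  refine harmonicSliceLiouville h ht₀ fun x => ?_
  rw [laplacian_eq_neg_curl_curl hu2 (h.isDivFree ht₀) x, hfun, curl_const_eq_zero, neg_zero]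

/-- **Harmonic-vorticity pocket** (engine of `Row_A2fs`): `Δω(t₀,·) = 0` on a nonempty open set of
one slice kills the element (`analyticOnNhd_curl`, `analyticOnNhd_laplacian`, identity theorem,
`harmonicVorticitySliceLiouville`). -/
theorem harmonicVorticityWindowLiouville (h : IsTypeIAncientMild C u) {t₀ : ℝ} (ht₀ : t₀ < 0)
    {U : Set E3} (hU : IsOpen U) (hne : U.Nonempty) (h0 : ∀ x ∈ U, Δ (curl (u t₀)) x = 0) :
    ∀ t < 0, ∀ x, u t x = 0 :=
  harmonicVorticitySliceLiouville h ht₀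
    (eq_zero_of_window (analyticOnNhd_laplacian (analyticOnNhd_curl (h.analyticOnNhd_slice_univ ht₀)))
      hU hne h0)

/-! ## D. The pressure source `Q = tr((∇u)²)` -/

/-- The PRESSURE SOURCE of a velocity slice: `Q(f)(x) = tr(Df(x) ∘ Df(x)) = Σᵢⱼ ∂ⱼfᵢ(x) ∂ᵢfⱼ(x)`.
For a divergence-free slice the pressure Poisson equation reads `Δp = −Q`, and
`Q = |S|² − ½|ω|²` (`S` the strain, `ω` the vorticity). -/
noncomputable def gradSqTrace (f : E3 → E3) (x : E3) : ℝ :=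
  LinearMap.trace ℝ E3 (((fderiv ℝ f x).comp (fderiv ℝ f x) : E3 →L[ℝ] E3) : E3 →ₗ[ℝ] E3)

/-- `Q(f)` is real-analytic when `f` is (trace of the square of the analytic Jacobian). -/
theorem analyticOnNhd_gradSqTrace {f : E3 → E3} (hf : AnalyticOnNhd ℝ f univ) :
    AnalyticOnNhd ℝ (gradSqTrace f) univ := by
  have hD : AnalyticOnNhd ℝ (fderiv ℝ f) univ := hf.fderiv
  have hcomp : AnalyticOnNhd ℝ
      (fun x => ContinuousLinearMap.compL ℝ E3 E3 E3 (fderiv ℝ f x) (fderiv ℝ f x)) univ :=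
    ((ContinuousLinearMap.compL ℝ E3 E3 E3).analyticOnNhd_bilinear univ).comp₂ hD hD
      fun _ _ => mem_univ _
  set L : (E3 →L[ℝ] E3) →ₗ[ℝ] ℝ := (LinearMap.trace ℝ E3) ∘ₗ (ContinuousLinearMap.coeLM ℝ) with hL
  have e : gradSqTrace f = fun x => (LinearMap.toContinuousLinearMap L)
      (ContinuousLinearMap.compL ℝ E3 E3 E3 (fderiv ℝ f x) (fderiv ℝ f x)) := by
    funext x
    simp [gradSqTrace, hL]
  rw [e]
  exact (LinearMap.toContinuousLinearMap L).comp_analyticOnNhd hcomp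

/-- Pocket ⇒ slice for the pressure source: `Q(u(t₀)) = 0` on a nonempty open set of a slice of a
class element forces `Q(u(t₀)) ≡ 0` on `ℝ³` (slice analyticity + identity theorem). -/
theorem gradSqTrace_eq_zero_of_window (h : IsTypeIAncientMild C u) {t₀ : ℝ} (ht₀ : t₀ < 0)
    {U : Set E3} (hU : IsOpen U) (hne : U.Nonempty) (h0 : ∀ x ∈ U, gradSqTrace (u t₀) x = 0) :
    ∀ x, gradSqTrace (u t₀) x = 0 :=
  eq_zero_of_window (analyticOnNhd_gradSqTrace (h.analyticOnNhd_slice_univ ht₀)) hU hne h0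

/-! ## E. Census rows ((L′)-shape, BY NAME over `IsTypeIAncientMild`) -/

/-- Row A2fh — HARMONIC SLICE ⇒ trivial.  DECIDED (proved: `row_A2fh`). -/
def Row_A2fh : Prop :=
  ∀ (C : ℝ) (u : ℝ → E3 → E3), IsTypeIAncientMild C u →
    (∃ t₀ < 0, ∀ x, Δ (u t₀) x = 0) → ∀ t < 0, ∀ x, u t x = 0

/-- Row A2fw — FORCE-FREE POCKET on one slice ⇒ trivial.  DECIDED (proved: `row_A2fw`). -/
def Row_A2fw : Prop :=
  ∀ (C : ℝ) (u : ℝ → E3 → E3), IsTypeIAncientMild C u →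
    (∃ t₀ < 0, ∃ U : Set E3, IsOpen U ∧ U.Nonempty ∧ ∀ x ∈ U, Δ (u t₀) x = 0) →
    ∀ t < 0, ∀ x, u t x = 0

/-- Row A2fj — FORCE JET flat at ONE point of one slice ⇒ trivial.  DECIDED (proved: `row_A2fj`). -/
def Row_A2fj : Prop :=
  ∀ (C : ℝ) (u : ℝ → E3 → E3), IsTypeIAncientMild C u →
    (∃ t₀ < 0, ∃ x₀ : E3, ∀ n : ℕ, iteratedFDeriv ℝ n (Δ (u t₀)) x₀ = 0) →
    ∀ t < 0, ∀ x, u t x = 0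

/-- Row A2fs — HARMONIC-VORTICITY POCKET on one slice ⇒ trivial.  DECIDED (proved: `row_A2fs`). -/
def Row_A2fs : Prop :=
  ∀ (C : ℝ) (u : ℝ → E3 → E3), IsTypeIAncientMild C u →
    (∃ t₀ < 0, ∃ U : Set E3, IsOpen U ∧ U.Nonempty ∧ ∀ x ∈ U, Δ (curl (u t₀)) x = 0) →
    ∀ t < 0, ∀ x, u t x = 0

/-- Row A2fq — PRESSURE-HARMONIC POCKET (`Q = tr((∇u)²) = 0` on a nonempty open set of one slice)
⇒ trivial.  OPEN, typed. -/
@[conjecture] def Row_A2fq : Prop :=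
  ∀ (C : ℝ) (u : ℝ → E3 → E3), IsTypeIAncientMild C u →
    (∃ t₀ < 0, ∃ U : Set E3, IsOpen U ∧ U.Nonempty ∧ ∀ x ∈ U, gradSqTrace (u t₀) x = 0) →
    ∀ t < 0, ∀ x, u t x = 0

/-- Row A2fQ — PRESSURELESS INSTANT (`Q(u(t₀)) ≡ 0` on `ℝ³` for one `t₀ < 0`) ⇒ trivial.
OPEN, typed; equivalent to `Row_A2fq` (`row_A2fQ_iff_A2fq`). -/
@[conjecture] def Row_A2fQ : Prop :=
  ∀ (C : ℝ) (u : ℝ → E3 → E3), IsTypeIAncientMild C u →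
    (∃ t₀ < 0, ∀ x, gradSqTrace (u t₀) x = 0) → ∀ t < 0, ∀ x, u t x = 0

/-! ## F. Verdicts -/

/-- **Row A2fh holds** (harmonic slice). -/
theorem row_A2fh : Row_A2fh := fun _ _ hu ⟨_, ht₀, hΔ⟩ => harmonicSliceLiouville hu ht₀ hΔ

/-- **Row A2fw holds** (force-free pocket). -/
theorem row_A2fw : Row_A2fw := fun _ _ hu ⟨_, ht₀, _, hU, hne, h0⟩ =>
  forceFreeWindowLiouville hu ht₀ hU hne h0

/-- **Row A2fj holds** (force jet). -/
theorem row_A2fj : Row_A2fj := fun _ _ hu ⟨_, ht₀, _, hflat⟩ => forceJetLiouville hu ht₀ hflat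

/-- **Row A2fs holds** (harmonic-vorticity pocket). -/
theorem row_A2fs : Row_A2fs := fun _ _ hu ⟨_, ht₀, _, hU, hne, h0⟩ =>
  harmonicVorticityWindowLiouville hu ht₀ hU hne h0

/-- Formal nesting: the pocket cell implies the slice cell. -/
theorem row_A2fw_imp_A2fh : Row_A2fw → Row_A2fh := fun h C u hu ⟨t₀, ht₀, hΔ⟩ =>
  h C u hu ⟨t₀, ht₀, univ, isOpen_univ, univ_nonempty, fun x _ => hΔ x⟩

/-- Formal nesting: the jet cell implies the pocket cell (a function vanishing on a pocket has a
flat jet at each of its points). -/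
theorem row_A2fj_imp_A2fw : Row_A2fj → Row_A2fw := fun h C u hu ⟨t₀, ht₀, _, hU, ⟨x₀, hx₀⟩, h0⟩ =>
  h C u hu ⟨t₀, ht₀, x₀, flat_of_eventually_eq_zero (by
    filter_upwards [hU.mem_nhds hx₀] with z hz
    exact h0 z hz)⟩

/-- The OPEN pressure cell: pocket form ⇒ slice form (trivial direction). -/
theorem row_A2fq_imp_A2fQ : Row_A2fq → Row_A2fQ := fun h C u hu ⟨t₀, ht₀, hQ⟩ =>
  h C u hu ⟨t₀, ht₀, univ, isOpen_univ, univ_nonempty, fun x _ => hQ x⟩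

/-- The OPEN pressure cell: slice form ⇒ pocket form (analyticity of `Q`, identity theorem). -/
theorem row_A2fQ_imp_A2fq : Row_A2fQ → Row_A2fq := fun h C u hu ⟨t₀, ht₀, _, hU, hne, h0⟩ =>
  h C u hu ⟨t₀, ht₀, gradSqTrace_eq_zero_of_window hu ht₀ hU hne h0⟩

/-- The OPEN pressure cell: slice form ⇔ pocket form. -/
theorem row_A2fQ_iff_A2fq : Row_A2fQ ↔ Row_A2fq := ⟨row_A2fQ_imp_A2fq, row_A2fq_imp_A2fQ⟩

/-- (L′) implies every row (the rows are weakenings of the rung). -/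
theorem rows_of_L' (hL : ∀ (C : ℝ) (u : ℝ → E3 → E3), IsTypeIAncientMild C u →
      ∀ t < 0, ∀ x, u t x = 0) :
    Row_A2fh ∧ Row_A2fw ∧ Row_A2fj ∧ Row_A2fs ∧ Row_A2fq ∧ Row_A2fQ :=
  ⟨fun C u hu _ => hL C u hu, fun C u hu _ => hL C u hu, fun C u hu _ => hL C u hu,
    fun C u hu _ => hL C u hu, fun C u hu _ => hL C u hu, fun C u hu _ => hL C u hu⟩

end Summit.NavierStokesRegularity.NavierStokesRegularity.Theorems.ScenarioCensus.ForceMeter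

namespace Summit.NavierStokesRegularity.NavierStokesRegularity.Theorems.ScenarioCensus

/-! ## Census KEYS (ns `…Theorems.ScenarioCensus`): instrument FORCE METER (block A2) — TREE-decided cells A2fh / A2fw / A2fj / A2fs, OPEN rows A2fq ⇔ A2fQ -/

/-- **Cell A2fh** (HARMONIC SLICE: `Δu(t₀) ≡ 0` for one `t₀ < 0` ⇒ `u ≡ 0`): `:= ForceMeter.Row_A2fh`. DECIDED. -/
def Row_A2fh : Prop := ForceMeter.Row_A2fh
/-- A2fh is EXCLUDED (decided in the tree): `ForceMeter.row_A2fh`. -/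
theorem row_A2fh_excluded : Row_A2fh := ForceMeter.row_A2fh

/-- **Cell A2fw** (FORCE-FREE POCKET: `Δu(t₀) = 0` on a nonempty open set of one slice ⇒ `u ≡ 0`): `:= ForceMeter.Row_A2fw`. DECIDED. -/
def Row_A2fw : Prop := ForceMeter.Row_A2fw
/-- A2fw is EXCLUDED (decided in the tree): `ForceMeter.row_A2fw`. -/
theorem row_A2fw_excluded : Row_A2fw := ForceMeter.row_A2fw

/-- **Cell A2fj** (FORCE JET flat at ONE point of one slice ⇒ `u ≡ 0`): `:= ForceMeter.Row_A2fj`. DECIDED. -/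
def Row_A2fj : Prop := ForceMeter.Row_A2fj
/-- A2fj is EXCLUDED (decided in the tree): `ForceMeter.row_A2fj`. -/
theorem row_A2fj_excluded : Row_A2fj := ForceMeter.row_A2fj

/-- **Cell A2fs** (HARMONIC-VORTICITY POCKET on one slice ⇒ `u ≡ 0`): `:= ForceMeter.Row_A2fs`. DECIDED. -/
def Row_A2fs : Prop := ForceMeter.Row_A2fs
/-- A2fs is EXCLUDED (decided in the tree): `ForceMeter.row_A2fs`. -/
theorem row_A2fs_excluded : Row_A2fs := ForceMeter.row_A2fs

/-- **Row A2fq** (PRESSURE-HARMONIC POCKET: `Q = tr((∇u)²) = 0` on a nonempty open set of one slice ⇒ `u ≡ 0`) — typed only: `:= ForceMeter.Row_A2fq`. OPEN (no witness, no proof). -/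
@[conjecture] def Row_A2fq : Prop := ForceMeter.Row_A2fq

/-- **Row A2fQ** (PRESSURELESS INSTANT: `Q(u(t₀)) ≡ 0` on `ℝ³` for one `t₀ < 0` ⇒ `u ≡ 0`) — typed only, equivalent to `Row_A2fq`: `:= ForceMeter.Row_A2fQ`. OPEN. -/
@[conjecture] def Row_A2fQ : Prop := ForceMeter.Row_A2fQ

/-- Lattice edges at key level: A2fj → A2fw → A2fh (`ForceMeter.row_A2fj_imp_A2fw` / `row_A2fw_imp_A2fh`), A2fQ ↔ A2fq (`row_A2fQ_iff_A2fq`). -/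
theorem row_A2fw_of_row_A2fj : Row_A2fj → Row_A2fw := ForceMeter.row_A2fj_imp_A2fw
/-- See `row_A2fw_of_row_A2fj`. -/
theorem row_A2fh_of_row_A2fw : Row_A2fw → Row_A2fh := ForceMeter.row_A2fw_imp_A2fh
/-- See `row_A2fw_of_row_A2fj`. -/
theorem row_A2fq_of_row_A2fQ : Row_A2fQ → Row_A2fq := ForceMeter.row_A2fQ_imp_A2fq
/-- See `row_A2fw_of_row_A2fj`. -/
theorem row_A2fQ_of_row_A2fq : Row_A2fq → Row_A2fQ := ForceMeter.row_A2fq_imp_A2fQ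

end Summit.NavierStokesRegularity.NavierStokesRegularity.Theorems.ScenarioCensus

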